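import Literature.Geometry.Kaehler.ComplexTorusMapsLinear
import Literature.Geometry.Kaehler.ComplexTorusHolomorphicDescent
import Mathlib.Analysis.Real.Cardinality
import Mathlib.LinearAlgebra.Basis.VectorSpace
import HarnessLib

/-!
# A bijective holomorphic map of complex tori fixing `0` is an additive biholomorphism with a linear lift
# ([LangeBirkenhake1992] Ch. 1 §2 Prop. 2.1; [BirkenhakeLange2004] §1.2 Prop. 1.2.1; [MumfordAV1970] §1)

Layer `Literature/Geometry/Kaehler`, namespace `Literature.Geometry.Kaehler.ComplexTorus`.  THEOREMS ONLY (no definition, no named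
fact, no instance, no notation, no `sorry`).  Cell `hodgecm-mathlib` (D-0151), FLOOR 0, P6 «MOD» (crux hLiu418 = stmt-HodgeConjecture-24832,
`--supports`), «L8-PREP» organ O4 `FIBREGRP` of LA1-plan (g2)'s HOME skeleton `StubRELEXP` (the RIGIDITY brick (iv) of the road posted
on the F0/P6 bus 04:23Z by the payer LA5-p01 (g2)).  HC_CM is proved only modulo the 7 printed citations (2 remaining: hLiu418 =
stmt-HodgeConjecture-24832, h413 = stmt-HodgeConjecture-24833) until rung 0 closes; this file is generic complex-torus theory, count-neutral.

THE MATHEMATICS ([LangeBirkenhake1992] Ch. 1 §2 Prop. 2.1 ∕ [BirkenhakeLange2004] §1.2 Prop. 1.2.1: a holomorphic map of complex tori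
is a translate of a homomorphism whose analytic representation `ρₐ` is `ℂ`-linear; an isomorphism of complex tori has an invertible
analytic representation).  Let `F : X = E∕Φ(ℤ^ι) → X' = E'∕Φ'(ℤ^{ι'})` be a HOLOMORPHIC BIJECTION of complex tori with `F 0 = 0`.
By the tree's rigidity ★ `ComplexTorus.exists_clm_of_mdifferentiable`, `F ∘ π = π' ∘ (f · + c)` with `f` `ℂ`-linear and `π' c = 0`, so
`F ∘ π = π' ∘ f` and `F` is ADDITIVE.  The linear part `f` is INJECTIVE: its kernel is a real subspace contained in the lattice
`Φ(ℤ^ι)` (injectivity of `F`), and a real line inside a countable set is impossible (`ℝ` is uncountable).  It is SURJECTIVE: by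
surjectivity of `F`, `E' = f(E) + Φ'(ℤ^{ι'})`; if `f(E) ≠ E'` a nonzero real functional `ℓ` vanishing on `f(E)` would map `E'` onto
`ℝ` with countable image `ℓ(Φ'(ℤ^{ι'}))`.  Hence `f : E ≃ E'` is a linear isomorphism, `F⁻¹ ∘ π' = π ∘ f⁻¹` is holomorphic
(★ `mdifferentiable_comp_cover_iff`), and `F` is an additive homeomorphism with holomorphic inverse.

* `exists_addHomeomorph_of_bijective_mdifferentiable` — THE HEAD: `F` is (the coercion of) a homeomorphism `T : X ≃ₜ X'`, additive,
  holomorphic with holomorphic inverse, with a `ℂ`-linear isomorphism `f : E ≃L[ℂ] E'` lifting it (`F (π z) = π' (f z)`,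
  `T⁻¹ (π' w) = π (f⁻¹ w)`) and matching the lattices (`f Φ(ℤ^ι) ⊆ Φ'(ℤ^{ι'})`, `f⁻¹ Φ'(ℤ^{ι'}) ⊆ Φ(ℤ^ι)`).

## References
* [LangeBirkenhake1992] H. Lange, Ch. Birkenhake, *Complex Abelian Varieties* (1992), Ch. 1 §2 Prop. 2.1.
* [BirkenhakeLange2004] C. Birkenhake, H. Lange, *Complex Abelian Varieties*, 2nd ed. (2004), §1.2 Prop. 1.2.1 (p. 10).
* [MumfordAV1970] D. Mumford, *Abelian Varieties* (1970), §1 (1)–(2).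
-/

set_option autoImplicit false

noncomputable section

open scoped Manifold ContDiff Topology
open Set Function Filter

namespace Literature.Geometry.Kaehler

namespace ComplexTorus

variable {ι ι' : Type*} [Fintype ι] [Fintype ι']
  {E E' : Type*} [NormedAddCommGroup E] [NormedSpace ℂ E] [NormedAddCommGroup E'] [NormedSpace ℂ E']
  {Φ : (ι → ℝ) ≃L[ℝ] E} {Φ' : (ι' → ℝ) ≃L[ℝ] E'}

omit [Fintype ι] [Fintype ι'] in
/-- A vector all of whose real multiples lie in a countable set is zero (a real line is uncountable). Used: the kernel of the
analytic representation of an injective torus map, a real subspace inside the lattice, is trivial.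
[cite: LangeBirkenhake1992, Ch. 1 §2 Prop. 2.1] -/
private theorem eq_zero_of_forall_smul_mem_countable {S : Set E} (hS : S.Countable) {z : E} (h : ∀ t : ℝ, t • z ∈ S) :
    z = 0 := by
  by_contra hz
  have hinj : Injective fun t : ℝ => t • z := smul_left_injective ℝ hz
  have hpre : (fun t : ℝ => t • z) ⁻¹' S = univ := eq_univ_of_forall fun t => h t
  have hcount : ((fun t : ℝ => t • z) ⁻¹' S).Countable := hS.preimage_of_injOn hinj.injOn
  rw [hpre] at hcount
  exact Cardinal.not_countable_real hcount

omit [Fintype ι] [Fintype ι'] in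
/-- A real subspace `V` of `E'` whose translates by a countable set cover `E'` is all of `E'` (otherwise a nonzero real functional
vanishing on `V` maps `E'` onto the uncountable `ℝ` with countable image). Used: the analytic representation of a surjective torus
map is onto, since `E' = f(E) + Φ'(ℤ^{ι'})`. [cite: LangeBirkenhake1992, Ch. 1 §2 Prop. 2.1] -/
private theorem eq_top_of_forall_exists_add_mem_countable (V : Submodule ℝ E') {S : Set E'} (hS : S.Countable)
    (h : ∀ w : E', ∃ v ∈ V, ∃ s ∈ S, w = v + s) : V = ⊤ := by
  by_contra hV
  obtain ⟨ℓ, hℓ0, hℓV⟩ := Submodule.exists_le_ker_of_lt_top V (lt_top_iff_ne_top.2 hV)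
  -- a vector on which `ℓ` does not vanish
  obtain ⟨w₀, hw₀⟩ : ∃ w₀ : E', ℓ w₀ ≠ 0 := by
    by_contra hall
    exact hℓ0 (LinearMap.ext fun w => by simpa using not_exists.1 hall w)
  -- every real number is `ℓ s` for some `s ∈ S`
  have hcover : (univ : Set ℝ) ⊆ ℓ '' S := by
    intro t _
    obtain ⟨v, hv, s, hs, hvs⟩ := h ((t / ℓ w₀) • w₀)
    refine ⟨s, hs, ?_⟩
    have hℓv : ℓ v = 0 := by
      have := hℓV hv
      rwa [LinearMap.mem_ker] at this
    have h1 : ℓ ((t / ℓ w₀) • w₀) = ℓ v + ℓ s := by rw [hvs, map_add]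
    rw [map_smul, smul_eq_mul, div_mul_cancel₀ t hw₀, hℓv, zero_add] at h1
    exact h1.symm
  exact Cardinal.not_countable_real ((hS.image ℓ).mono hcover)

omit [Fintype ι] in
/-- The lattice `Φ(ℤ^ι)` of a complex torus is a countable subset of `E`. [cite: LangeBirkenhake1992, Ch. 1 §1 (lattices)] -/
private theorem countable_range_latticeVec [Finite ι] : (Set.range (latticeVec Φ)).Countable :=
  Set.countable_range _

/-- **A BIJECTIVE HOLOMORPHIC MAP OF COMPLEX TORI FIXING `0` IS AN ADDITIVE BIHOLOMORPHISM WITH A LINEAR ISOMORPHISM AS LIFT.**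
Let `F : E∕Φ(ℤ^ι) → E'∕Φ'(ℤ^{ι'})` be holomorphic, bijective, with `F 0 = 0` (`E`, `E'` finite-dimensional).  Then `F` is (the
coercion of) a homeomorphism `T`, ADDITIVE, holomorphic with HOLOMORPHIC INVERSE, and there is a `ℂ`-linear isomorphism
`f : E ≃L[ℂ] E'` with `F (π z) = π' (f z)` and `T⁻¹ (π' w) = π (f⁻¹ w)`, carrying the lattices onto each other (`f Φ(ℤ^ι) ⊆ Φ'(ℤ^{ι'})`,
`f⁻¹ Φ'(ℤ^{ι'}) ⊆ Φ(ℤ^ι)`) — the analytic representation of an isomorphism of complex tori is invertible.  (Rigidity ★ `exists_clm_of_mdifferentiable` gives the affine lift `f · + c` with `π' c = 0`; `ker f ⊆ Φ(ℤ^ι)` is a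
real subspace inside a countable set, hence `0`; `f(E) + Φ'(ℤ^{ι'}) = E'` forces `f(E) = E'`; then `F⁻¹ ∘ π' = π ∘ f⁻¹`.)
[cite: LangeBirkenhake1992, Ch. 1 §2 Prop. 2.1] [cite: BirkenhakeLange2004, §1.2 Prop. 1.2.1 (p. 10)] [cite: MumfordAV1970, §1 (1)–(2)] -/
theorem exists_addHomeomorph_of_bijective_mdifferentiable [FiniteDimensional ℂ E] [FiniteDimensional ℂ E']
    {F : ComplexTorus Φ → ComplexTorus Φ'} (hF : MDifferentiable 𝓘(ℂ, E) 𝓘(ℂ, E') F) (hbij : Bijective F)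
    (h0 : F 0 = 0) :
    ∃ (T : ComplexTorus Φ ≃ₜ ComplexTorus Φ') (f : E ≃L[ℂ] E'),
      (⇑T = F) ∧ (∀ x y, T (x + y) = T x + T y) ∧
      MDifferentiable 𝓘(ℂ, E) 𝓘(ℂ, E') T ∧ MDifferentiable 𝓘(ℂ, E') 𝓘(ℂ, E) T.symm ∧
      (∀ z, F (cover Φ z) = cover Φ' (f z)) ∧ (∀ w, T.symm (cover Φ' w) = cover Φ (f.symm w)) ∧
      (∀ n : ι → ℤ, ∃ m : ι' → ℤ, f (latticeVec Φ n) = latticeVec Φ' m) ∧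
      (∀ m : ι' → ℤ, ∃ n : ι → ℤ, f.symm (latticeVec Φ' m) = latticeVec Φ n) := by
  classical
  -- rigidity: an affine lift with `ℂ`-linear linear part
  obtain ⟨f₀, c, hFc, hlat⟩ := exists_clm_of_mdifferentiable hF
  have hc0 : cover Φ' c = 0 := by
    have h := hFc 0
    rw [cover_zero, h0, map_zero, zero_add] at h
    exact h.symm
  have hFz : ∀ z, F (cover Φ z) = cover Φ' (f₀ z) := by
    intro z
    rw [hFc z, cover_add, hc0, add_zero]
  -- the linear part is injective: its kernel is a real subspace inside the lattice
  have hinj : Injective f₀ := by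
    rw [injective_iff_map_eq_zero]
    intro z hz
    have hker : ∀ t : ℝ, t • z ∈ Set.range (latticeVec Φ) := by
      intro t
      have h1 : f₀ (t • z) = 0 := by rw [ContinuousLinearMap.map_smul_of_tower, hz, smul_zero]
      have h2 : F (cover Φ (t • z)) = F 0 := by rw [hFz, h1, cover_zero, h0]
      have h3 : cover Φ (t • z) = 0 := hbij.1 h2
      obtain ⟨n, hn⟩ := (cover_eq_zero_iff Φ _).1 h3
      exact ⟨n, hn.symm⟩
    exact eq_zero_of_forall_smul_mem_countable (countable_range_latticeVec (Φ := Φ)) hker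
  -- the linear part is surjective: `f₀(E) + Φ'(ℤ^{ι'}) = E'`
  have hsurj : Surjective f₀ := by
    have htop : LinearMap.range ((f₀ : E →L[ℂ] E').restrictScalars ℝ : E →ₗ[ℝ] E') = ⊤ := by
      refine eq_top_of_forall_exists_add_mem_countable _ (countable_range_latticeVec (Φ := Φ')) fun w => ?_
      obtain ⟨x, hx⟩ := hbij.2 (cover Φ' w)
      obtain ⟨z, rfl⟩ := cover_surjective Φ x
      rw [hFz] at hx
      obtain ⟨n, hn⟩ := (cover_eq_cover_iff Φ' _ _).1 hx.symm
      exact ⟨f₀ z, ⟨z, rfl⟩, latticeVec Φ' n, ⟨n, rfl⟩, hn⟩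
    intro w
    have hw : w ∈ LinearMap.range ((f₀ : E →L[ℂ] E').restrictScalars ℝ : E →ₗ[ℝ] E') := by rw [htop]; trivial
    obtain ⟨z, hz⟩ := hw
    exact ⟨z, hz⟩
  let f : E ≃L[ℂ] E' := (LinearEquiv.ofBijective (f₀ : E →ₗ[ℂ] E') ⟨hinj, hsurj⟩).toContinuousLinearEquiv
  have hf : ∀ z, f z = f₀ z := fun z => rfl
  -- the set-theoretic inverse reads `π ∘ f⁻¹` on the covering
  let T₀ : ComplexTorus Φ ≃ ComplexTorus Φ' := Equiv.ofBijective F hbij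
  have hT₀ : ⇑T₀ = F := rfl
  have hT₀symm : ∀ w, T₀.symm (cover Φ' w) = cover Φ (f.symm w) := by
    intro w
    apply T₀.injective
    rw [Equiv.apply_symm_apply, hT₀, hFz, ← hf, ContinuousLinearEquiv.apply_symm_apply]
  -- continuity (compact source, Hausdorff target) and the homeomorphism
  let T : ComplexTorus Φ ≃ₜ ComplexTorus Φ' := Continuous.homeoOfEquivCompactToT2 (f := T₀) hF.continuous
  have hT : ⇑T = F := rfl
  have hTsymm : ∀ y, T.symm y = T₀.symm y := fun y => rfl
  refine ⟨T, f, hT, ?_, by rw [hT]; exact hF, ?_, fun z => by rw [hFz, hf], fun w => by rw [hTsymm, hT₀symm],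
    fun n => by rw [hf]; exact hlat n, fun m => ?_⟩
  · -- additivity
    intro x y
    obtain ⟨z, rfl⟩ := cover_surjective Φ x
    obtain ⟨w, rfl⟩ := cover_surjective Φ y
    rw [hT, ← cover_add, hFz, hFz, hFz, map_add, cover_add]
  · -- holomorphy of the inverse: `T⁻¹ ∘ π' = π ∘ f⁻¹`
    have hcomp : (T.symm : ComplexTorus Φ' → ComplexTorus Φ) ∘ cover Φ' = cover Φ ∘ (f.symm : E' → E) := by
      funext w
      simp only [comp_apply, hTsymm, hT₀symm]
    have hd : MDifferentiable 𝓘(ℂ, E') 𝓘(ℂ, E) ((T.symm : ComplexTorus Φ' → ComplexTorus Φ) ∘ cover Φ') := by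
      rw [hcomp]
      exact (mdifferentiable_cover Φ).comp f.symm.mdifferentiable
    exact (mdifferentiable_comp_cover_iff (Φ := Φ')).1 hd
  · -- the inverse lift carries `Φ'(ℤ^{ι'})` into `Φ(ℤ^ι)`
    have h1 : T₀.symm (cover Φ' (latticeVec Φ' m)) = cover Φ (f.symm (latticeVec Φ' m)) := hT₀symm _
    have h2 : T₀.symm (cover Φ' (latticeVec Φ' m)) = 0 := by
      apply T₀.injective
      rw [Equiv.apply_symm_apply, cover_latticeVec, hT₀, h0]
    rw [h2] at h1
    exact (cover_eq_zero_iff Φ _).1 h1.symm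

end ComplexTorus

end Literature.Geometry.Kaehler

end
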